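import Summits.QuantumFields.YangMills.Theorems.BalabanUVNodesN15KingModelBoxBlockField
import Literature.MathematicalPhysics.QuantumFieldTheory.King1986.CovarianceQstarRate
import HarnessLib

/-!
# BalabanUVNodes ∕ N15 — THE KING-MODEL RUNG (PART Ν-i): NE2's UNIT LAYER ON KING's REGION `Ω` — THE RG BLOCK-FIELD COVARIANCE WITH FREE BOUNDARY
# CONDITIONS DECAYS UNIFORMLY AND ITS `η`-RATE IS `O(L^{−k})`: `|(Δ^{(k+n)}_Ω)⁻¹(b,b′) − (Δ^{(k)}_Ω)⁻¹(b,b′)| ≤ 2^{d+1}·C_diff·L^{−k}·e^{−(κ_m∕2)·d_Ω(b,b′)}`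
# — the torus theorem of record of this lineage's g0 rung (`blockCov_step_le`) transported to the box through the folding homomorphism
# (Track A, DAG node N15 = NE2; FAN-OUT v1.1 §N15 s3 «KING-MODEL RUNG»: NE2's analogue DECIDED in the model — now on a box `Ω` with Neumann b.c.; count-neutral)

HONEST FRAMING.  Count-neutral (cell `pub-ymgap`, seat `pub-ymgap-dag-n15-e` g39; `--supports stmt-QuantumFields-27366 --as helper` = K3⁸).
TEMPLATE LITERATURE: C. King, Commun. Math. Phys. **102** (1986) 649–677 [King1986]: Lemma 4.3 (4.18) p.672 and (4.34) p.674 (uniform decay of the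
block-field covariance), (4.39)–(4.41) pp.674–675 (its `η`-rate), §4 p.670 (l.8–13: the Ω-propagators are multiple-reflection sums, after [Ba 4] = [Balaban1983RegularityDecay] (2.42), of the operator with
free boundary conditions, «so it is sufficient to prove Propositions 3.8 and 3.9 for the operator with free boundary conditions»; here the transfer is run
from the TORUS of doubled periods — the periodized form of [Ba 4]'s series, parts Ν-f∕Ν-g — on which this lineage carries King's kernels).  The g0 rung of this seat typed NE2's unit layer in King's
model ON THE TORUS: `blockCov_step_le` = `King1986.CovarianceQstarRate.effLaplacian_inv_sub_decay` (and `…QstarDecay.effLaplacian_inv_decay`), stated for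
EVERY unit torus `Tor M′`.  THIS FILE carries both over to the box with Neumann («free») boundary conditions: with `M′ = dblPer n` (the doubled unit torus of the box `Ω = Π_μ{0,…,n_μ−1}`)
and part Ν-g's `(Δ^{(k)}_Ω)⁻¹ = fold((Δ^{(k)})⁻¹)`, the difference of two box covariances is the fold of the difference of the torus covariances
(`foldOp_sub`), and part Ν-f's transport `abs_foldOp_le_exp_of_torusDecay` (every image is at least as far as the direct term) gives:
★★★ **`abs_fold_blockCov_le`** — `|(Δ^{(k)}_Ω)⁻¹(b,b′)| ≤ 2^{d+1}·(2∕γ_m)·e^{−κ_m·d_Ω(b,b′)}` uniformly in `k ≥ 1` and in the box;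
★★★ **`abs_fold_blockCov_sub_le`** — `|(Δ^{(k+n₁)}_Ω)⁻¹ − (Δ^{(k)}_Ω)⁻¹|(b,b′) ≤ 2^{d+1}·C_diff·L^{−k}·e^{−(κ_m∕2)·d_Ω(b,b′)}` (NE2's unit-layer `η`-RATE on `Ω`:
SAME rate `L^{−k}`, SAME decay `κ_m∕2`, constant `× 2^{d+1}`), its one-step form `abs_fold_blockCov_step_le` (summable in `K`: the box covariances converge
as `K → ∞` at rate `L^{−K}`, uniformly in `Ω`), and ★★ `abs_fold_blockCov_sub_torus_le_of_bulk` (in the bulk the box covariance IS the torus covariance up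
to `(2^{d+1}−1)(2∕γ_m)e^{−κ_m(2r+1)}`).  Constants `γ_m = gamM a m² L`, `κ_m = kapM (d+1) a m² L`, `C_diff = CdiffM (d+1) a m² L` — the torus constants,
functions of `d, L, a, m²` only; `d_Ω(b,b′) = tdistT_{T(2n)}(dblBox b, dblBox b′)` the box sup-distance (part Ν-c: `≥ |b_μ − b′_μ|` for every `μ`).
NOT Bałaban's covariant objects; NOT a node discharge (N15 is booked through n15-a's knit, untouched; the typed NE2 predicates `EtaRateIneqUnit` ∕ `N15At`
are carried by torus geometries in this lineage and are not re-instantiated on a box carrier here); `Δ^{(k)}_Ω` is King's definition-by-folding; nothing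
continuum-YM ∕ `ℝ⁴` ∕ OS axioms ∕ Clay.  0 `sorry`, 0 `def`.

WHAT THIS FILE PROVES (kernel).  §1 `foldOp_sub`, `foldOp_apply_sub`.  §2 ★★★ **`abs_fold_blockCov_le`**, ★★★ **`abs_fold_blockCov_sub_le`**, ★★★ `abs_fold_blockCov_step_le`,
★★ `abs_fold_blockCov_sub_torus_le_of_bulk`.

HONEST SCOPE.  `a, m² > 0`, `L ≥ 2`, `k ≥ 1`, `n₁ ≥ 1`; King's units (`N = L^k` fine points per block side, `a_k = aK a L k`, `c = L^{2k}`); any `d`, any unit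
box sides `n_μ ≥ 1`.  King's `A = 0` scalar model; N15 untouched; counts unmoved.  Locators: [King1986] Lemma 4.3 (4.18) p.672, (4.34) p.674, (4.39)–(4.41)
pp.674–675, (2.14) p.653, §4 p.670.
-/

noncomputable section

open scoped BigOperators symmDiff
open Finset Matrix

namespace Summit.QuantumFields.YangMills.BalabanUVNodes.N15KingModelRung.TorusSpectral

open Literature.MathematicalPhysics.QuantumFieldTheory.Balaban1983to89.B5Prop11Plancherel (Tor fine unitVec)
open Literature.MathematicalPhysics.QuantumFieldTheory.Balaban1983to89.QGQInverse (Coercive isUnit_of_coercive)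
open Literature.MathematicalPhysics.QuantumFieldTheory.King1986 (aK aK_pos)
open Literature.MathematicalPhysics.QuantumFieldTheory.King1986.Torus

variable {d : ℕ}

/-! ## §1 Folding differences -/

section FoldSub

variable (n : Fin (d + 1) → ℕ) [hn : ∀ μ, NeZero (n μ)]

omit hn in
/-- `fold(A − B) = fold(A) − fold(B)`. [folklore] -/
theorem foldOp_sub (A B : Matrix (Tor (dblPer n)) (Tor (dblPer n)) ℝ) : foldOp n (A - B) = foldOp n A - foldOp n B := by
  ext s t; simp [foldOp, Finset.sum_sub_distrib]

omit hn in
/-- `fold(A)(s,t) − fold(B)(s,t) = fold(A − B)(s,t)`. [folklore] -/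
theorem foldOp_apply_sub (A B : Matrix (Tor (dblPer n)) (Tor (dblPer n)) ℝ) (s t : KingBox n) :
    foldOp n A s t - foldOp n B s t = foldOp n (A - B) s t := by
  rw [foldOp_sub, Matrix.sub_apply]

end FoldSub

/-! ## §2 NE2's unit layer on King's region `Ω`: uniform decay and the `η`-rate of the RG block-field covariance with free boundary conditions -/

section EtaRate

variable (L : ℕ) [NeZero L] (n : Fin (d + 1) → ℕ) [hn : ∀ μ, NeZero (n μ)]

/-- ★★★ **UNIFORM DECAY OF THE RG BLOCK-FIELD COVARIANCE ON `Ω` WITH FREE BOUNDARY CONDITIONS** (King's units, level `k ≥ 1`: `N = L^k` fine points per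
block side, `a_k = aK a L k`, `c = L^{2k}`): for `a, m² > 0`, `L ≥ 2`, every unit box `Ω = Π_μ{0,…,n_μ−1}` and all blocks `b, b′`,
`|(Δ^{(k)}_Ω)⁻¹(b,b′)| ≤ 2^{d+1}·(2∕γ_m)·e^{−κ_m·d_Ω(b,b′)}` with the TORUS constants `γ_m = gamM a m² L`, `κ_m = kapM (d+1) a m² L` of
`King1986.CovarianceQstarDecay.effLaplacian_inv_decay` (uniform in `k` and in the box) and the box sup-distance `d_Ω(b,b′) = tdistT_{T(2n)}(dblBox b, dblBox b′)`
— the torus estimate transferred to `Ω` through part Ν-f's folding. [cite: King1986, Lemma 4.3 (4.18) p.672, (4.34) p.674, §4 p.670] -/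
theorem abs_fold_blockCov_le (hL : 2 ≤ L) {a m2 : ℝ} (ha : 0 < a) (hm : 0 < m2) {k : ℕ} (hk : 1 ≤ k) (b b' : KingBox n) :
    |(foldOp n (effLaplacian (L ^ k) (dblPer n) (aK a L k) (((L ^ k : ℕ) : ℝ) ^ 2) m2))⁻¹ b b'|
      ≤ 2 ^ (d + 1) * ((2 / gamM a m2 L) * Real.exp (-(kapM (d + 1) a m2 L * tdistT (dblPer n) (dblBox n b) (dblBox n b')))) := by
  have hL1 : (1 : ℝ) < L := by exact_mod_cast lt_of_lt_of_le one_lt_two hL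
  rw [foldOp_effLaplacian_inv (L ^ k) n (aK_pos ha hL1 hk) (by positivity) hm]
  refine abs_foldOp_le_exp_of_torusDecay n _ (le_of_lt (div_pos two_pos (gamM_pos ha hm hL))) (le_of_lt (kapM_pos_le (d := d + 1) ha hm hL).1) ?_ b b'
  intro w w'
  exact effLaplacian_inv_decay ha hm hL hk (dblPer n) w w'

/-- ★★★ **NE2's UNIT-LAYER `η`-RATE ON KING's REGION `Ω` — THE RG BLOCK-FIELD COVARIANCES OF TWO LEVELS WITH FREE BOUNDARY CONDITIONS DIFFER BY
`O(L^{−k})` WITH UNIFORM EXPONENTIAL DECAY.**  For `a, m² > 0`, `L ≥ 2`, levels `k ≥ 1` (lattice spacing `L^{−k}`) and `k + n₁` (`n₁ ≥ 1`), every unit box `Ω`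
and all blocks `b, b′`:
`|(Δ^{(k+n₁)}_Ω)⁻¹(b,b′) − (Δ^{(k)}_Ω)⁻¹(b,b′)| ≤ 2^{d+1}·C_diff·L^{−k}·e^{−(κ_m∕2)·d_Ω(b,b′)}`, `C_diff = CdiffM (d+1) a m² L`, `κ_m = kapM (d+1) a m² L` — the torus
theorem `King1986.CovarianceQstarRate.effLaplacian_inv_sub_decay` (this lineage's g0 headline `blockCov_step_le` = NE2's unit layer DECIDED in King's model
on the torus) transported to King's ACTUAL region through the folding homomorphism: the difference of the two box covariances is the fold of the
difference of the torus covariances (`foldOp_effLaplacian_inv`, `foldOp_sub`), and every image is at least as far as the direct term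
(`abs_foldOp_le_exp_of_torusDecay`).  SAME rate `L^{−k}`, SAME decay `κ_m∕2`, constant `× 2^{d+1}`.
[cite: King1986, (4.39)–(4.41) pp.674–675, Lemma 4.3 (4.18) p.672, §4 p.670] -/
theorem abs_fold_blockCov_sub_le (hL : 2 ≤ L) {a m2 : ℝ} (ha : 0 < a) (hm : 0 < m2) {k n₁ : ℕ} (hk : 1 ≤ k) (hn₁ : 1 ≤ n₁) (b b' : KingBox n) :
    |(foldOp n (effLaplacian (L ^ n₁ * L ^ k) (dblPer n) (aK a L (k + n₁)) (((L ^ n₁ * L ^ k : ℕ) : ℝ) ^ 2) m2))⁻¹ b b'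
        - (foldOp n (effLaplacian (L ^ k) (dblPer n) (aK a L k) (((L ^ k : ℕ) : ℝ) ^ 2) m2))⁻¹ b b'|
      ≤ 2 ^ (d + 1) * (CdiffM (d + 1) a m2 L * ((L : ℝ) ^ k)⁻¹
          * Real.exp (-(kapM (d + 1) a m2 L / 2 * tdistT (dblPer n) (dblBox n b) (dblBox n b')))) := by
  have hL1 : (1 : ℝ) < L := by exact_mod_cast lt_of_lt_of_le one_lt_two hL
  rw [foldOp_effLaplacian_inv (L ^ n₁ * L ^ k) n (aK_pos ha hL1 (le_trans hk (Nat.le_add_right k n₁))) (by positivity) hm,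
    foldOp_effLaplacian_inv (L ^ k) n (aK_pos ha hL1 hk) (by positivity) hm, foldOp_apply_sub]
  have hC : 0 ≤ CdiffM (d + 1) a m2 L * ((L : ℝ) ^ k)⁻¹ := mul_nonneg (CdiffM_nonneg ha hm hL) (by positivity)
  have hκ : 0 ≤ kapM (d + 1) a m2 L / 2 := by have := (kapM_pos_le (d := d + 1) ha hm hL).1; positivity
  refine abs_foldOp_le_exp_of_torusDecay n _ hC hκ ?_ b b'
  intro w w'
  rw [Matrix.sub_apply]
  exact effLaplacian_inv_sub_decay ha hm hL hk hn₁ (dblPer n) w w'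

/-- ★★★ **KING's INDEXATION (one RG step, `K → K+1`)**: `|(Δ^{(K+1)}_Ω)⁻¹(b,b′) − (Δ^{(K)}_Ω)⁻¹(b,b′)| ≤ 2^{d+1}·C_diff·L^{−K}·e^{−(κ_m∕2)·d_Ω(b,b′)}` — the box form of
`blockCov_step_le` (part (g0) `…KingModelRungUnit`): summable in `K`, so the box block-field covariances converge as `K → ∞` at rate `L^{−K}`, uniformly in `Ω`.
[cite: King1986, (4.39)–(4.41) pp.674–675, §4 p.670] -/
theorem abs_fold_blockCov_step_le (hL : 2 ≤ L) {a m2 : ℝ} (ha : 0 < a) (hm : 0 < m2) {K : ℕ} (hK : 1 ≤ K) (b b' : KingBox n) :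
    |(foldOp n (effLaplacian (L ^ 1 * L ^ K) (dblPer n) (aK a L (K + 1)) (((L ^ 1 * L ^ K : ℕ) : ℝ) ^ 2) m2))⁻¹ b b'
        - (foldOp n (effLaplacian (L ^ K) (dblPer n) (aK a L K) (((L ^ K : ℕ) : ℝ) ^ 2) m2))⁻¹ b b'|
      ≤ 2 ^ (d + 1) * (CdiffM (d + 1) a m2 L * ((L : ℝ) ^ K)⁻¹
          * Real.exp (-(kapM (d + 1) a m2 L / 2 * tdistT (dblPer n) (dblBox n b) (dblBox n b')))) :=
  abs_fold_blockCov_sub_le L n hL ha hm hK le_rfl b b'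

/-- ★★ **IN THE BULK THE BOX AND TORUS BLOCK-FIELD COVARIANCES AGREE** up to exponentially small boundary images: for blocks `b, b′` at distance `≥ r` from every
face of `Ω`, `|(Δ^{(k)}_Ω)⁻¹(b,b′) − (Δ^{(k)}_{T(2n)})⁻¹(dblBox b, dblBox b′)| ≤ (2^{d+1}−1)·(2∕γ_m)·e^{−κ_m(2r+1)}`. [cite: King1986, Lemma 4.3 (4.18) p.672, §4 p.670] -/
theorem abs_fold_blockCov_sub_torus_le_of_bulk (hL : 2 ≤ L) {a m2 : ℝ} (ha : 0 < a) (hm : 0 < m2) {k : ℕ} (hk : 1 ≤ k) (b b' : KingBox n) {r : ℕ}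
    (hbulk : ∀ μ, r ≤ (b μ).val ∧ r ≤ (b' μ).val ∧ (b μ).val + r < n μ ∧ (b' μ).val + r < n μ) :
    |(foldOp n (effLaplacian (L ^ k) (dblPer n) (aK a L k) (((L ^ k : ℕ) : ℝ) ^ 2) m2))⁻¹ b b'
        - (effLaplacian (L ^ k) (dblPer n) (aK a L k) (((L ^ k : ℕ) : ℝ) ^ 2) m2)⁻¹ (dblBox n b) (dblBox n b')|
      ≤ (2 ^ (d + 1) - 1) * ((2 / gamM a m2 L) * Real.exp (-(kapM (d + 1) a m2 L * (2 * r + 1)))) := by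
  have hL1 : (1 : ℝ) < L := by exact_mod_cast lt_of_lt_of_le one_lt_two hL
  rw [foldOp_effLaplacian_inv (L ^ k) n (aK_pos ha hL1 hk) (by positivity) hm]
  refine abs_foldOp_sub_direct_le_of_bulk n _ (le_of_lt (div_pos two_pos (gamM_pos ha hm hL))) (le_of_lt (kapM_pos_le (d := d + 1) ha hm hL).1) ?_ b b' hbulk
  intro w w'
  exact effLaplacian_inv_decay ha hm hL hk (dblPer n) w w'

end EtaRate

end Summit.QuantumFields.YangMills.BalabanUVNodes.N15KingModelRung.TorusSpectral
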